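import Summits.BirchSwinnertonDyer.BirchSwinnertonDyer.Theorems.RamifiedSevenEllipticUnitsRubinFormulaZpBsdp
import Summits.BirchSwinnertonDyer.BirchSwinnertonDyer.Theses.RamifiedSevenEllipticUnits
import HarnessLib

set_option linter.dupNamespace false
set_option autoImplicit false

/-!
# Route `RamifiedSevenEllipticUnits` (rung K7r): the E-Zp VALUE crux `EllipticUnitValueSevenOfGZK`
# (stmt-BirchSwinnertonDyer-19945) is EQUIVALENT to `BSD(·, 7)` on 𝒞₇ modulo the route's residual
# `EllipticUnitIMCSevenZp` (stmt-BirchSwinnertonDyer-19944) and four published facts — the `…Zp` analogue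
# of seat k7r-c4 g4's `RamifiedSevenEllipticUnitsValueIffBsdpAnyPrime` (p448797) over the CORRECTED carrier
# (cell `bsd-cm`, seat `bsd-cm-k7r-c4` g6; witness-of-weakness bookkeeping; `--supports` 19945)

HONEST FRAMING. Nothing here proves BSD for any curve; the crux 19945 stays OPEN and the residual 19944
(the anticyclotomic elliptic-unit IMC at the ramified prime, ∃-form over `𝒪_𝔭 · z(𝟙)`) stays an open
conjecture-grade input. This file only RECORDS, in the kernel, what the repaired value crux IS:

* (any-prime seams `…IndexLawAtZp_of_bsdp` / `bsdp_of_…IndexLawAtZp_of_imcZp` / `…_iff_bsdp_of_imcZp`: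
  seat k7r-c3 g7's `RubinFormulaZpBsdp`, landed first, imported); at route level on 𝒞₇ (this file):
  `ellipticUnitValueSevenOfGZK_iff_bsdpOnClassCSeven_of_imcZp` —
  **`EllipticUnitIMCSevenZp → (EllipticUnitValueSevenOfGZK ↔ (GZK → ∀ W ∈ 𝒞₇, BSD(W, 7)))`** granted
  `hasEntireLFunction_rat`, `GrossZagier1986_thm_I_7_3`, `bsdRHS_eq_of_isIsogenous` (all conjuncts of
  `PublishedFactsSeven`). So the attacked crux is EXACTLY the `7`-part of BSD on the class, relative to the
  residual — as for its predecessor 19705 (p465172 ∘ p448797), now over the satisfiable carrier.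

References: R. Miller, LMS J. Comput. Math. 14 (2011) Def. 1.1 [Miller2011LMS]; J. W. S. Cassels (1965)
[Cassels1965ArithmeticVIII]; [BKNO] arXiv:2608.06879v1 Thm. 3.14 (3), §1.4 (shape only)
[BurungaleKobayashiNakamuraOta2026].
-/

noncomputable section

open scoped Classical

open WeierstrassCurve NumberField IsDedekindDomain Field
  Literature.NumberTheory.EllipticCurves
  Literature.NumberTheory.EllipticCurves.Rank1Residual
  Literature.NumberTheory.EllipticCurves.BurungaleKobayashiNakamuraOta2026
  Literature.NumberTheory.GaloisRepresentations
  Summit.BirchSwinnertonDyer.Rank1Residual.Additive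

namespace Summit.BirchSwinnertonDyer.BirchSwinnertonDyer.Theorems.RamifiedSevenEllipticUnits

open Summit.BirchSwinnertonDyer.Rank1Residual Summit.BirchSwinnertonDyer.Rank1Residual.X12.O11
  Summit.BirchSwinnertonDyer.BirchSwinnertonDyer.Theses.RamifiedSevenEllipticUnits

namespace ValueZpIffBsdp

/-! (The any-prime seams `ramifiedCMBottomClassIndexLawAtZp_of_bsdp`,
`bsdp_of_ramifiedCMBottomClassIndexLawAtZp_of_imcZp`, `…_iff_bsdp_of_imcZp` are seat k7r-c3 g7's
`RubinFormulaZpBsdp` file, landed first; this file adds only the ROUTE-LEVEL statements on 𝒞₇.) -/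


section ClassCSeven

/-- **Route level: `EllipticUnitIMCSevenZp → (EllipticUnitValueSevenOfGZK ↔ (GZK → BSD(·, 7) on 𝒞₇))`**,
granted modularity, Gross–Zagier I.7.3 and Cassels (conjuncts of `PublishedFactsSeven`; GZK rides inside
both sides). The attacked E-Zp crux of route K7r is EXACTLY the `7`-part of BSD on the class 𝒞₇ relative
to the route's residual (stmt-BirchSwinnertonDyer-19944). [cite: Miller2011LMS, Def. 1.1 (arXiv:1010.2431 p. 3)]
[cite: Cassels1965ArithmeticVIII] -/
theorem ellipticUnitValueSevenOfGZK_iff_bsdpOnClassCSeven_of_imcZp (hmod : hasEntireLFunction_rat)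
    (hGZ : GrossZagier1986_thm_I_7_3) (hCassels : bsdRHS_eq_of_isIsogenous) (h1 : EllipticUnitIMCSevenZp) :
    EllipticUnitValueSevenOfGZK ↔
      (rank_eq_analyticRank_of_analyticRank_le_one →
        ∀ (W : WeierstrassCurve ℚ) [W.IsElliptic] [W.IsGloballyMinimal] [Fact (Nat.Prime 7)],
          X12.ClassCSeven W → BSDp W 7) := by
  constructor
  · intro h hGZK W _ _ _ hC
    exact RubinFormulaZpBsdp.bsdp_of_ramifiedCMBottomClassIndexLawAtZp_of_imcZp hmod hGZ hGZK hCassels (h1 W hC) hC.1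
      (X12.ClassCSeven.cmRamified_seven hC) (by norm_num) hC.2.2.1 (h hGZK W hC)
  · intro h hGZK W _ _ _ hC
    exact RubinFormulaZpBsdp.ramifiedCMBottomClassIndexLawAtZp_of_bsdp hCassels hmod hGZK (le_of_eq hC.2.2.1)
      (h hGZK W hC)

/-- **`BSD(·, 7)` on 𝒞₇ ⟹ the E-Zp value crux**, granted Cassels and modularity only (no residual
needed in this direction): wherever `BSD(W, 7)` is certified on the class (Route U, per member) the
repaired value law holds. [cite: Miller2011LMS, Def. 1.1 (arXiv:1010.2431 p. 3)] [cite: Cassels1965ArithmeticVIII] -/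
theorem ellipticUnitValueSevenOfGZK_of_bsdpOnClassCSeven (hCassels : bsdRHS_eq_of_isIsogenous)
    (hmod : hasEntireLFunction_rat)
    (hB : ∀ (W : WeierstrassCurve ℚ) [W.IsElliptic] [W.IsGloballyMinimal] [Fact (Nat.Prime 7)],
      X12.ClassCSeven W → BSDp W 7) :
    EllipticUnitValueSevenOfGZK :=
  fun hGZK W _ _ _ hC ↦
    RubinFormulaZpBsdp.ramifiedCMBottomClassIndexLawAtZp_of_bsdp hCassels hmod hGZK (le_of_eq hC.2.2.1) (hB W hC)

end ClassCSeven

end ValueZpIffBsdp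

end Summit.BirchSwinnertonDyer.BirchSwinnertonDyer.Theorems.RamifiedSevenEllipticUnits

end
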